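import Summits.QuantumFields.YangMills.Theorems.BalabanUVNodesN15KingModelPauliLinksGap
import HarnessLib

/-!
# BalabanUVNodes ∕ N15 — THE KING-MODEL RUNG (PART Ϸ-h): WHY NON-COMMUTATION IS NEEDED — a COMMON EIGENVECTOR `ζ` of the constant links (`W_μζ = λ_μζ`) caps the spectrum from above by the
# ABELIAN quantity `m² + c·Σ_μ|1 − ψ_μ(q)λ_μ|²` at every momentum, and at a RESONANT momentum (`ψ_μ(q)λ_μ = 1` for all `μ`) the plane wave `χ_q ⊗ ζ` is a parallel section: `m²` IS an
# eigenvalue and the massless `−cΔ_W` is NOT positive definite — in contrast with the Pauli pair (PART Ϸ-d), which therefore has no resonant common eigenvector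
# (Track A, DAG node N15 = NE2; FAN-OUT v1.1 §N15 s3 «KING-MODEL RUNG … + what the curved case adds»; count-neutral)

HONEST FRAMING.  Count-neutral (cell `pub-ymgap`, seat `pub-ymgap-dag-n15-e` g48; `--supports stmt-QuantumFields-27247 --as helper` = K3ᴬ, KEY MAP v3).  Exact finite statements for King's
fine covariance layer `−cΔ_U + m²` (Ͱ-a `covLapF`) at constant unitary links (Ϸ-a `kingConstLink`), ANY fibre `ℂⁿ`; NOT Bałaban's `G_k(U)`; NOT a node discharge; nothing continuum ∕ ℝ⁴ ∕
OS ∕ Clay.  Commuting unitary links are simultaneously diagonalisable, hence have common eigenvectors: the file isolates the mechanism (a common eigenvector = an abelian sub-connection = a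
toron of PART Ͷ inside the non-abelian field) without the diagonalisation theorem.

THE RESULTS (`K` any period vector; `W : Fin(d+1) → U(n)`; `ζ ≠ 0` with `W_μζ = λ_μζ` for all `μ`; `ψ_μ(q) = χ_q(e_μ)`):
* §1 `toEuclideanLin_toLp_of_mulVec_eq_smul`, ★★ **`re_form_fibreOp_of_common_eigenvector`** (`Re⟨ζ, H_W(q)ζ⟩ = (m² + c·Σ_μ|1 − ψ_μ(q)λ_μ|²)·Σ_i|ζ_i|²`: on `ζ` the fibre form is the
  ABELIAN form of the eigenphases), ★★ **`exists_eigenvalue_le_of_common_eigenvector`** (every momentum `q`: `∃ i, λ_i ≤ m² + c·Σ_μ|1 − ψ_μ(q)λ_μ|²` — Ϸ-b Rayleigh);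
* §2 RESONANCE: `conjTranspose_mulVec_of_resonant` (`W^*ζ = ψ_μζ` when `ψ_μλ_μ = 1`), ★★★ **`fibreOp_mulVec_of_resonant`** (`ψ_μ(q)λ_μ = 1 ∀μ ⟹ H_W(q)ζ = m²·ζ`: the dressed plane wave is
  COVARIANTLY CONSTANT in every direction), ★★★ **`exists_eigenvalue_eq_mass_of_resonant`** (`m²` IS an eigenvalue on the torus), ★★ **`not_posDef_massless_of_resonant`** (the massless
  `−cΔ_W` is NOT positive definite); the case `q = 0`: ★★ `not_posDef_massless_of_common_fixed_vector` (all `W_μ` FIX a common `ζ ≠ 0` ⟹ the constant section `ζ` is a zero mode — e.g.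
  `W ≡ 1`, block-diagonal links `1 ⊕ W′_μ`);
* §3 THE CONTRAST: ★★ **`pauli_no_resonant_common_eigenvector`** (`c > 0`, `sin a·sin b ≠ 0`: the Pauli pair admits NO common eigenvector resonant at any momentum — by Ϸ-d's positive
  definiteness), `pauli_no_common_fixed_vector`.
PRIOR TREE ART (by name): Ϸ-a (`kingConstLink`, `kingConstLink_mem_unitaryGroup`), Ϸ-b (`fibreOp`, `re_form_fibreOp_eq`, `exists_eigenvalue_le_fibre`, `exists_eigenvalue_eq_of_fibre`,
`rclike_ofReal_complex`), Ϸ-c (`pauliLink`), Ϸ-d (`posDef_covLapF_pauliLink_massless`), Ͱ-a (`isHermitian_covLapF`), `TorusSpectral.norm_chi_eq_one`, Mathlib (`Matrix.PosDef.eigenvalues_pos`,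
`Matrix.mem_unitaryGroup_iff'`).  Dedup (rg at filing): basename 0 files; needles `of_common_eigenvector|of_resonant|pauli_no_resonant` 0 tree files.  Locators: [King1986] (4.4) p.670, (4.35)
p.674; [Balaban1985BackgroundPropagators] (3.23) p.394; [DodziukMathai2006] §1 Cor 1.3; [HornJohnson2013] Thm 4.2.2.  0 `sorry`, 0 `def`.
-/

noncomputable section

open scoped BigOperators ComplexConjugate ComplexOrder InnerProductSpace
open Finset Matrix WithLp

namespace Summit.QuantumFields.YangMills.BalabanUVNodes.N15KingModelRung.ConstantCurvature

open Literature.MathematicalPhysics.QuantumFieldTheory.Balaban1983to89.B5Prop11Plancherel (Tor unitVec chi)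
open Summit.QuantumFields.YangMills.BalabanUVNodes.N15KingModelRung.Covariant (covLapF fib isHermitian_covLapF)
open Summit.QuantumFields.YangMills.BalabanUVNodes.N15KingModelRung.TorusSpectral (norm_chi_eq_one)

variable {d : ℕ} (K : Fin (d + 1) → ℕ) [hK : ∀ μ, NeZero (K μ)]
variable {n : Type*} [Fintype n] [DecidableEq n]

/-! ## §1 A common eigenvector caps the spectrum by the abelian form of its eigenphases -/

section Cap

omit hK in
/-- `Wζ = λζ` on `EuclideanSpace`: `toEuclideanLin W (toLp ζ) = λ • toLp ζ`. [folklore] -/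
theorem toEuclideanLin_toLp_of_mulVec_eq_smul {W : Matrix n n ℂ} {ζ : n → ℂ} {lam : ℂ} (h : W *ᵥ ζ = lam • ζ) :
    Matrix.toEuclideanLin W (toLp 2 ζ) = lam • (toLp 2 ζ : EuclideanSpace ℂ n) := by
  rw [Matrix.toLpLin_apply, ofLp_toLp, h, WithLp.toLp_smul]

/-- ★★ **ON A COMMON EIGENVECTOR THE FIBRE FORM IS ABELIAN**: `W_μζ = λ_μζ` (all `μ`, `W_μ` unitary) ⟹ `Re⟨ζ, H_W(q)ζ⟩ = (m² + c·Σ_μ|1 − ψ_μ(q)λ_μ|²)·Σ_i|ζ_i|²` — the `d+1`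
eigenphases `λ_μ` act as a constant ABELIAN link field (a toron) on the line `ℂζ`. [cite: King1986, (4.4) p.670, (4.35) p.674; Balaban1985BackgroundPropagators, (3.23) p.394] -/
theorem re_form_fibreOp_of_common_eigenvector {W : Fin (d + 1) → Matrix n n ℂ} (hW : ∀ μ, W μ ∈ Matrix.unitaryGroup n ℂ) {ζ : n → ℂ} {lam : Fin (d + 1) → ℂ}
    (heig : ∀ μ, W μ *ᵥ ζ = lam μ • ζ) (c m2 : ℝ) (q : Tor K) :
    RCLike.re (star ζ ⬝ᵥ (fibreOp K W c m2 q *ᵥ ζ)) = (m2 + c * ∑ μ, ‖1 - chi K q (unitVec K μ) * lam μ‖ ^ 2) * ∑ i, ‖ζ i‖ ^ 2 := by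
  rw [re_form_fibreOp_eq K hW c m2 q ζ]
  have hnorm : ‖(toLp 2 ζ : EuclideanSpace ℂ n)‖ ^ 2 = ∑ i, ‖ζ i‖ ^ 2 := by rw [EuclideanSpace.norm_sq_eq]
  have hterm : ∀ μ, ‖(toLp 2 ζ : EuclideanSpace ℂ n) - chi K q (unitVec K μ) • Matrix.toEuclideanLin (W μ) (toLp 2 ζ)‖ ^ 2 = ‖1 - chi K q (unitVec K μ) * lam μ‖ ^ 2 * ∑ i, ‖ζ i‖ ^ 2 :=
    fun μ => by
      rw [toEuclideanLin_toLp_of_mulVec_eq_smul (heig μ), smul_smul, ← hnorm]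
      have : (toLp 2 ζ : EuclideanSpace ℂ n) - (chi K q (unitVec K μ) * lam μ) • (toLp 2 ζ : EuclideanSpace ℂ n) = (1 - chi K q (unitVec K μ) * lam μ) • (toLp 2 ζ : EuclideanSpace ℂ n) := by
        rw [sub_smul, one_smul]
      rw [this, norm_smul, mul_pow]
  simp only [hterm, ← Finset.sum_mul]
  ring

/-- ★★ **A COMMON EIGENVECTOR CAPS THE SPECTRUM**: for every momentum `q`, SOME eigenvalue of `−cΔ_W + m²` on the torus is `≤ m² + c·Σ_μ|1 − ψ_μ(q)λ_μ|²` (`ζ ≠ 0`; Ϸ-b's Rayleigh on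
`χ_q ⊗ ζ`) — no coercivity constant can exceed the ABELIAN holonomy quantity of the eigenphases. [cite: HornJohnson2013, Thm 4.2.2; King1986, (4.4) p.670, (4.35) p.674] -/
theorem exists_eigenvalue_le_of_common_eigenvector {W : Fin (d + 1) → Matrix n n ℂ} (hW : ∀ μ, W μ ∈ Matrix.unitaryGroup n ℂ) {ζ : n → ℂ} (hζ : ζ ≠ 0) {lam : Fin (d + 1) → ℂ}
    (heig : ∀ μ, W μ *ᵥ ζ = lam μ • ζ) (c m2 : ℝ) (q : Tor K) :
    ∃ i, (isHermitian_covLapF K c m2 (kingConstLink K W)).eigenvalues i ≤ m2 + c * ∑ μ, ‖1 - chi K q (unitVec K μ) * lam μ‖ ^ 2 := by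
  obtain ⟨i, hi⟩ := exists_eigenvalue_le_fibre K W c m2 q hζ
  refine ⟨i, hi.trans_eq ?_⟩
  have hpos : 0 < ∑ i, ‖ζ i‖ ^ 2 := (Literature.LinearAlgebra.Matrix.RayleighQuotient.sum_norm_sq_pos_iff ζ).mpr hζ
  rw [re_form_fibreOp_of_common_eigenvector K hW heig c m2 q, mul_div_assoc, div_self hpos.ne', mul_one]

end Cap

/-! ## §2 Resonance: a parallel section, `m²` an eigenvalue, no mass -/

section Resonant

omit hK in
/-- For a unitary `W` with `Wζ = λζ` and a phase `ψ` with `ψλ = 1`: `W^*ζ = ψζ` (`W^*W = 1`, `λ⁻¹ = ψ`). [folklore] -/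
theorem conjTranspose_mulVec_of_resonant {W : Matrix n n ℂ} (hW : W ∈ Matrix.unitaryGroup n ℂ) {ζ : n → ℂ} {lam ψ : ℂ} (h : W *ᵥ ζ = lam • ζ) (hres : ψ * lam = 1) :
    Wᴴ *ᵥ ζ = ψ • ζ := by
  have hWW : Wᴴ * W = 1 := by simpa only [Matrix.star_eq_conjTranspose] using Matrix.mem_unitaryGroup_iff'.mp hW
  have h1 : Wᴴ *ᵥ (W *ᵥ ζ) = ζ := by rw [Matrix.mulVec_mulVec, hWW, Matrix.one_mulVec]
  rw [h] at h1
  rw [Matrix.mulVec_smul] at h1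
  -- `λ • W^*ζ = ζ` ⟹ `W^*ζ = ψζ`
  have h2 : ψ • (lam • (Wᴴ *ᵥ ζ)) = ψ • ζ := by rw [h1]
  rw [smul_smul, hres, one_smul] at h2
  exact h2

/-- ★★★ **RESONANCE ⟹ A PARALLEL SECTION IN EVERY DIRECTION**: if `W_μζ = λ_μζ` and `ψ_μ(q)λ_μ = 1` for all `μ` then `H_W(q)ζ = m²·ζ` — every dressed hop of the plane wave
`χ_q ⊗ ζ` is the identity on it (`ψ_μW_μζ = ζ = ψ̄_μW_μ^*ζ`). [cite: King1986, (4.4) p.670, (4.35) p.674; DodziukMathai2006, Cor 1.3 §1] -/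
theorem fibreOp_mulVec_of_resonant {W : Fin (d + 1) → Matrix n n ℂ} (hW : ∀ μ, W μ ∈ Matrix.unitaryGroup n ℂ) {ζ : n → ℂ} {lam : Fin (d + 1) → ℂ}
    (heig : ∀ μ, W μ *ᵥ ζ = lam μ • ζ) (c m2 : ℝ) {q : Tor K} (hres : ∀ μ, chi K q (unitVec K μ) * lam μ = 1) :
    fibreOp K W c m2 q *ᵥ ζ = ((m2 : ℝ) : ℂ) • ζ := by
  have hterm : ∀ μ, (chi K q (unitVec K μ) • W μ + conj (chi K q (unitVec K μ)) • (W μ)ᴴ) *ᵥ ζ = (2 : ℂ) • ζ := fun μ => by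
    have hψ1 : conj (chi K q (unitVec K μ)) * chi K q (unitVec K μ) = 1 := by
      rw [← Complex.normSq_eq_conj_mul_self, Complex.normSq_eq_norm_sq, norm_chi_eq_one]; norm_num
    rw [Matrix.add_mulVec, Matrix.smul_mulVec, Matrix.smul_mulVec, heig μ, conjTranspose_mulVec_of_resonant (hW μ) (heig μ) (hres μ), smul_smul, smul_smul, hres μ, hψ1,
      ← add_smul]
    norm_num
  rw [fibreOp, Matrix.sub_mulVec, Matrix.smul_mulVec, Matrix.one_mulVec, Matrix.smul_mulVec, Matrix.sum_mulVec]
  simp only [hterm, Finset.sum_const, Finset.card_univ, Fintype.card_fin]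
  rw [← Nat.cast_smul_eq_nsmul ℂ, smul_smul, smul_smul, ← sub_smul]
  congr 1
  push_cast
  ring

/-- ★★★ **`m²` IS AN EIGENVALUE AT RESONANCE** (`ζ ≠ 0` a common eigenvector, `ψ_μ(q)λ_μ = 1` ∀`μ`): the bottom `m²` of King's `A = 0` spectrum is attained — NO mass is generated.
[cite: King1986, (4.4) p.670; DodziukMathai2006, Cor 1.3 §1; HornJohnson2013, Thm 4.2.2] -/
theorem exists_eigenvalue_eq_mass_of_resonant {W : Fin (d + 1) → Matrix n n ℂ} (hW : ∀ μ, W μ ∈ Matrix.unitaryGroup n ℂ) {ζ : n → ℂ} (hζ : ζ ≠ 0) {lam : Fin (d + 1) → ℂ}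
    (heig : ∀ μ, W μ *ᵥ ζ = lam μ • ζ) (c m2 : ℝ) {q : Tor K} (hres : ∀ μ, chi K q (unitVec K μ) * lam μ = 1) :
    ∃ i, (isHermitian_covLapF K c m2 (kingConstLink K W)).eigenvalues i = m2 :=
  exists_eigenvalue_eq_of_fibre K hζ (fibreOp_mulVec_of_resonant K hW heig c m2 hres)

/-- ★★ **NO MASS AT RESONANCE**: the MASSLESS `−cΔ_W` is NOT positive definite (it has the eigenvalue `0`), for EVERY `c`. [cite: DodziukMathai2006, Cor 1.3 §1; Balaban1985BackgroundPropagators, (3.23) p.394] -/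
theorem not_posDef_massless_of_resonant {W : Fin (d + 1) → Matrix n n ℂ} (hW : ∀ μ, W μ ∈ Matrix.unitaryGroup n ℂ) {ζ : n → ℂ} (hζ : ζ ≠ 0) {lam : Fin (d + 1) → ℂ}
    (heig : ∀ μ, W μ *ᵥ ζ = lam μ • ζ) (c : ℝ) {q : Tor K} (hres : ∀ μ, chi K q (unitVec K μ) * lam μ = 1) :
    ¬ (covLapF K c 0 (kingConstLink K W)).PosDef := by
  intro hpd
  obtain ⟨i, hi⟩ := exists_eigenvalue_eq_mass_of_resonant K hW hζ heig c 0 hres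
  have hpos := hpd.eigenvalues_pos i
  have h0 : (0 : ℝ) < 0 :=
    calc (0 : ℝ) < hpd.isHermitian.eigenvalues i := hpos
      _ = (isHermitian_covLapF K c 0 (kingConstLink K W)).eigenvalues i := rfl
      _ = 0 := hi
  exact lt_irrefl _ h0

/-- ★★ **A COMMON FIXED VECTOR IS A ZERO MODE** (`q = 0`): if every link FIXES the same `ζ ≠ 0` (`W_μζ = ζ`), the constant section `ζ` is covariantly constant and the massless `−cΔ_W` is
not positive definite — e.g. `W ≡ 1` (Ͱ-d), or block links `1 ⊕ W′_μ`. [cite: DodziukMathai2006, Cor 1.3 §1; King1986, (4.4) p.670] -/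
theorem not_posDef_massless_of_common_fixed_vector {W : Fin (d + 1) → Matrix n n ℂ} (hW : ∀ μ, W μ ∈ Matrix.unitaryGroup n ℂ) {ζ : n → ℂ} (hζ : ζ ≠ 0)
    (hfix : ∀ μ, W μ *ᵥ ζ = ζ) (c : ℝ) : ¬ (covLapF K c 0 (kingConstLink K W)).PosDef := by
  refine not_posDef_massless_of_resonant K hW hζ (lam := fun _ => 1) (fun μ => by rw [hfix μ, one_smul]) c (q := 0) fun μ => ?_
  rw [mul_one, Literature.MathematicalPhysics.QuantumFieldTheory.Balaban1983to89.B5Prop11Plancherel.chi_zero_left]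

end Resonant

/-! ## §3 The contrast: the Pauli pair has no resonant common eigenvector -/

section Contrast

/-- ★★ **THE PAULI PAIR HAS NO RESONANT COMMON EIGENVECTOR** (`c > 0`, `sin a·sin b ≠ 0`, `ν₀ ≠ ν₁`): no `ζ ≠ 0` is an eigenvector of every `W_μ` with eigenphases resonant at some
momentum — for then the massless operator would have a zero mode, against PART Ϸ-d's `posDef_covLapF_pauliLink_massless`. [cite: DodziukMathai2006, Cor 1.3 §1; King1986, (2.12) p.653] -/
theorem pauli_no_resonant_common_eigenvector {c : ℝ} (hc : 0 < c) {a b : ℝ} (ha : Real.sin a ≠ 0) (hb : Real.sin b ≠ 0) {ν₀ ν₁ : Fin (d + 1)} (hν : ν₀ ≠ ν₁)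
    {ζ : Fin 2 → ℂ} (hζ : ζ ≠ 0) {lam : Fin (d + 1) → ℂ} (heig : ∀ μ, pauliLink (d := d) a b ν₀ ν₁ μ *ᵥ ζ = lam μ • ζ) (q : Tor K) :
    ¬ (∀ μ, chi K q (unitVec K μ) * lam μ = 1) := fun hres =>
  not_posDef_massless_of_resonant K (pauliLink_mem_unitaryGroup a b ν₀ ν₁) hζ heig c hres (posDef_covLapF_pauliLink_massless K hc ha hb hν)

omit K hK in
/-- ★ … in particular the two Pauli links FIX no common non-zero vector (run the argument on the one-point torus). [cite: King1986, (2.12) p.653] -/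
theorem pauli_no_common_fixed_vector {a b : ℝ} (ha : Real.sin a ≠ 0) (hb : Real.sin b ≠ 0) {ν₀ ν₁ : Fin (d + 1)} (hν : ν₀ ≠ ν₁)
    {ζ : Fin 2 → ℂ} (hfix : ∀ μ, pauliLink (d := d) a b ν₀ ν₁ μ *ᵥ ζ = ζ) : ζ = 0 := by
  by_contra hζ
  exact not_posDef_massless_of_common_fixed_vector (fun _ : Fin (d + 1) => (1 : ℕ)) (pauliLink_mem_unitaryGroup a b ν₀ ν₁) hζ hfix 1
    (posDef_covLapF_pauliLink_massless (fun _ : Fin (d + 1) => (1 : ℕ)) one_pos ha hb hν)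

end Contrast

end Summit.QuantumFields.YangMills.BalabanUVNodes.N15KingModelRung.ConstantCurvature

end
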